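import Literature.Claims.NS.LucardoOlivaes2026
import Literature.Analysis.FluidPDE.NSVorticityBKMLocalExistence
import Literature.Analysis.FluidPDE.AxisymSmallSwirlL4
import Literature.Analysis.FluidPDE.NSLerayHopfSereginEnergyProofs
import Literature.Analysis.FluidPDE.TaoLocalisation
import Literature.Analysis.FluidPDE.EulerTimeScaling
import Literature.Barriers.NavierStokesRegularity.ScalingAudit
import Mathlib.Analysis.Calculus.BumpFunction.Basic
import HarnessLib

/-!
# D-0090 NS-CLAIMS, claim C137 `LucardoOlivaes2026` — kernel countermodel to the typed locator step (6)

Cell `ns-claims`; refuter `ns-claims-refuter-2` (g4) (typist `ns-claims-typist-10` g4, referee `ns-claims-ref-1` g4,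
filer `ns-claims-salvage-p4` g3, second reader `ns-claims-refuter-3` g3). Source: J. R. Lucardo Olivaes, Zenodo
10.5281/zenodo.21815761 (2026), 3 pp. The theorems NEGATE three `def … : Prop` of
`Literature.Claims.NS.LucardoOlivaes2026` at the print grain typed there, by CLASS-WIDE mechanisms:
* `not_Step6_StretchLower : ¬ Step6_StretchLower` — §4.1 display (6) p. 2 l. 44–54 «∫ ω·(ω·∇)u dV ≥
  C₁‖ω‖_{L^∞}‖ω‖²_{L²}», `C₁ > 0` a constant of the datum, at every time of every regular solution from an
  Ouroboros-class datum (CARD-predicted locator, SOLUTION grain). First failing step = `Step6_StretchLower` = (6)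
  p. 2 l. 44–54, class = false lemma (countermodel). Mechanism (`display6_fails_at_pair`): for EVERY datum `v` of
  the typed class the slice content of (6) fails at `v` or at `−v` — the class is closed under `v ↦ −v`, the left
  side `C₁·sup|ω|·∫|ω|²` is even and positive on the class, the stretching integral is odd. The solution-grain
  sentence is instantiated at `t = 0` for every `ν ≥ 0` (`stretchLower_fails_at_pair`) through the tree's PROVED
  local existence theorem `MajdaBertozzi2002_localExistenceH3_holds` (Thm. 3.4; `exists_isLocalSolution`).
* `not_step6F_perDatum` (the referee's charitable per-datum face R#2: `∀ v ∈ class, ∃ C₁ > 0, …`) and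
  `not_Step6F_StretchLower_fun : ¬ Step6F_StretchLower_fun` (uniform `C₁`) — same pair mechanism, no solutions.
* `not_Step7F_DissipRate_fun : ¬ Step7F_DissipRate_fun` — §5 p. 2 l. 56–66 «by Gagliardo–Nirenberg … the viscous
  term grows at a thermodynamic rate O(‖ω‖^{4/3}_{L²})» as `ν∫‖∇ω‖² ≤ C₃(∫‖ω‖²)^{2/3}` over the class: for EVERY
  datum `v₀` of the class and every `ν > 0` it fails along the datum's own amplitude ray `{A·v₀ : A > 0}` (which
  keeps every geometric feature of `v₀`), degrees `2 ≠ 4/3` (`dissipRate_ray_fails`, tree tool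
  `ScalingAudit.not_exists_forall_le_of_amplitude_exponent_ne`).

Explicit member used to instantiate the ∀-class sentences: the swirling bump `u₀(x) = ψ(|x|²)·(−x₁, x₀, 0)`, `ψ`
Mathlib's smooth plateau bump (`= 1` on `[−1,1]`, support in `(−2,2)`): `C^∞`, compactly supported, divergence
free, `curl u₀(0) = (0,0,2)` (`isOuroDatum_u0`). The typed class `IsOuroDatum` (the printed analytic content of
§3: `H^∞`, divergence free, compactly supported non-zero vorticity; §3's rings/knot/alignment prose has no printed
formula and is not typed) enters only through: closure under `A·` for `A ≠ 0` (`isOuroDatum_smul`), positivity of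
`∫|curl v|²`, `sup|curl v|`, `∫‖∇ curl v‖²` on it (`ens_pos`, `sup_pos`, `palin_pos`), and local existence.
Repair note (not a verdict): the pair mechanism misses only a reading of (6) restricted to data of positive
initial stretching on an unprinted «asymptotic regime»/region `Ω_r` (no such restriction or constant is printed —
unfilled gap if adopted); the §5 ray mechanism survives any such restriction that is invariant under `A > 0`.

WHAT THIS IS NOT: not a claim about NS regularity or blow-up; not a claim about any author beyond the typed
locator.
-/

-- The summit's canonical theorem namespace repeats the summit name (single-conjunct summit).
set_option linter.dupNamespace false

noncomputable section

open Real Set Function InnerProductSpace MeasureTheory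
open scoped RealInnerProductSpace ContDiff ENNReal NNReal

namespace Summit.NavierStokesRegularity.NavierStokesRegularity.Theorems.LucardoOlivaes2026

open Literature.Analysis.FluidPDE Literature.Barriers.NavierStokesRegularity
open Literature.Claims.NS.Chae2007 (IsDatum IsLocalSolution)
open Literature.Claims.NS.LucardoOlivaes2026

/-! ## W. An explicit member of the class: `u₀ = ψ(|x|²)·(−x₁, x₀, 0)` -/

/-- one-dimensional smooth plateau bump: `= 1` on `[-1,1]`, `= 0` outside `(-2,2)` [folklore] -/
def ψ : ContDiffBump (0 : ℝ) := ⟨1, 2, one_pos, one_lt_two⟩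

/-- radial plateau profile `Φb x = ψ(‖x‖²)` [folklore] -/
def Φb (x : E3) : ℝ := ψ (‖x‖ ^ 2)

/-- the swirling bump `u₀ = Φb · J x`, `J x = (−x₁, x₀, 0)` [folklore] -/
def u0 (x : E3) : E3 := Φb x • rotGenL x

/-- the profile is smooth [folklore] -/
theorem contDiff_Φb : ContDiff ℝ ∞ Φb :=
  ψ.contDiff.comp (contDiff_norm_sq ℝ)

/-- the witness is smooth [folklore] -/
theorem contDiff_u0 : ContDiff ℝ ∞ u0 :=
  contDiff_Φb.smul rotGenL.contDiff

/-- `Φb 0 = 1` [folklore] -/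
theorem Φb_zero : Φb 0 = 1 := by
  unfold Φb
  apply ψ.one_of_mem_closedBall
  simp [ψ]

/-- `Φb` vanishes outside the ball of radius `2` [folklore] -/
theorem Φb_eq_zero {x : E3} (hx : 2 ≤ ‖x‖) : Φb x = 0 := by
  unfold Φb
  apply ψ.zero_of_le_dist
  simp only [ψ, dist_zero_right, Real.norm_eq_abs]
  rw [abs_of_nonneg (sq_nonneg _)]
  nlinarith

/-- the witness is compactly supported [folklore] -/
theorem hasCompactSupport_u0 : HasCompactSupport u0 := by
  apply HasCompactSupport.intro (isCompact_closedBall (0 : E3) 2)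
  intro x hx
  have hx' : 2 ≤ ‖x‖ := by
    rw [Metric.mem_closedBall, dist_zero_right, not_le] at hx; exact hx.le
  simp [u0, Φb_eq_zero hx']

/-- the witness is divergence free (axisymmetric profile times the rotation field) [folklore] -/
theorem isDivFree_u0 : VectorCalculus.IsDivFree u0 := fun x =>
  divergence_smul_rotGenL (fun θ y => by simp [Φb, norm_rotZ]) ((contDiff_Φb.differentiable (by simp)) x)

/-- `curl u₀ (0) = (0, 0, 2)` [folklore] -/
theorem curl_u0_zero : curl u0 0 = EuclideanSpace.single 2 (2 : ℝ) := by
  have hΦb : DifferentiableAt ℝ Φb 0 := (contDiff_Φb.differentiable (by simp)) 0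
  have hD : ∀ h : E3, fderiv ℝ u0 0 h = rotGen h := by
    intro h
    have := fderiv_smul_rotGenL_apply (Φ := Φb) hΦb h
    rw [show u0 = fun y => Φb y • rotGenL y from rfl, this]
    simp [Φb_zero, rotGen]
  ext i
  simp only [curl, hD]
  fin_cases i
  · simp [rotGen]
  · simp [rotGen]
  · simp [rotGen]; norm_num

/-- **`u₀` is an Ouroboros-class datum**: smooth, divergence free, every derivative in `L²` (rapid decay
from compact support, tree lemmas), compactly supported vorticity, `curl u₀ (0) ≠ 0`. [folklore] -/
theorem isOuroDatum_u0 : IsOuroDatum u0 := by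
  refine ⟨⟨contDiff_u0, isDivFree_u0, fun n => ?_⟩, hasCompactSupport_curl hasCompactSupport_u0, fun h => ?_⟩
  · exact (HasRapidSpatialDecay.of_hasCompactSupport contDiff_u0
      hasCompactSupport_u0).lintegral_enorm_iteratedFDeriv_sq_lt_top n
  · have h0 := congrArg (fun w : E3 => w 2) (congr_fun h 0)
    simp [curl_u0_zero] at h0

/-! ## H. Homogeneity of the four functionals of (5)–(7) under `v ↦ l • v` (every field) -/

variable (l : ℝ) (v : E3 → E3)

/-- `curl (l v) = l curl v` (no differentiability needed: both sides are junk together) [folklore] -/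
theorem curl_smul_fun : curl (l • v) = fun x => l • curl v x := by
  funext x; exact curl_const_smul_field l v x

/-- enstrophy is quadratic [folklore] -/
theorem ens_smul : ∫ x, ‖curl (l • v) x‖ ^ 2 = l ^ 2 * ∫ x, ‖curl v x‖ ^ 2 := by
  rw [← integral_const_mul]
  congr 1; funext x
  rw [curl_smul_fun, norm_smul, mul_pow, Real.norm_eq_abs, sq_abs]

/-- the vorticity sup scales by `|l|` [folklore] -/
theorem sup_smul : (⨆ x, ‖curl (l • v) x‖) = |l| * ⨆ x, ‖curl v x‖ := by
  rw [Real.mul_iSup_of_nonneg (abs_nonneg l)]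
  congr 1; funext x
  rw [curl_smul_fun, norm_smul, Real.norm_eq_abs]

/-- palinstrophy (operator-norm encoding) is quadratic [folklore] -/
theorem palin_smul : ∫ x, ‖fderiv ℝ (curl (l • v)) x‖ ^ 2 = l ^ 2 * ∫ x, ‖fderiv ℝ (curl v) x‖ ^ 2 := by
  rw [← integral_const_mul]
  congr 1; funext x
  rw [curl_smul_fun, fderiv_const_smul_real, norm_smul, mul_pow, Real.norm_eq_abs, sq_abs]

/-- the stretching integral is CUBIC, hence odd [folklore] -/
theorem stretchI_smul : stretchI (l • v) = l ^ 3 * stretchI v := by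
  rw [stretchI, stretchI, ← integral_const_mul]
  congr 1; funext x
  have h : fderiv ℝ (l • v) x = l • fderiv ℝ v x := fderiv_const_smul_real l v x
  rw [curl_smul_fun, h, _root_.smul_apply, map_smul, inner_smul_left, inner_smul_right, inner_smul_right,
    RCLike.conj_to_real]
  ring

variable {l v}

/-! ## D. The typed class: closure under amplitude, positivity of the three functionals -/

/-- the `H^∞` datum class is closed under constant multiples [folklore] -/
theorem isDatum_smul (hv : IsDatum v) (l : ℝ) : IsDatum (l • v) := by
  refine ⟨(contDiff_const (c := l)).smul hv.1, fun x => ?_, fun n => ?_⟩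
  · have hd : DifferentiableAt ℝ v x := (hv.1.differentiable (by simp)) x
    have h0 := hv.2.1 x
    rw [VectorCalculus.divergence] at h0 ⊢
    rw [show (l • v) = fun y => l • v y from rfl, fderiv_fun_const_smul hd l]
    simp [h0]
  · have h : (fun x => ‖iteratedFDeriv ℝ n (l • v) x‖ₑ ^ 2) = fun x => ‖l‖ₑ ^ 2 * ‖iteratedFDeriv ℝ n v x‖ₑ ^ 2 := by
      funext x
      rw [show (l • v) = fun y => l • v y from rfl,
        iteratedFDeriv_const_smul_apply' (hv.1.of_le (by exact_mod_cast le_top)).contDiffAt, enorm_smul, mul_pow]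
    rw [h, lintegral_const_mul' _ _ (by simp)]
    exact ENNReal.mul_lt_top (by simp) (hv.2.2 n)

/-- **the Ouroboros class is closed under `v ↦ l • v`, `l ≠ 0`** — in particular under `v ↦ −v` and along
amplitude rays. [folklore] -/
theorem isOuroDatum_smul (hv : IsOuroDatum v) (hl : l ≠ 0) : IsOuroDatum (l • v) := by
  refine ⟨isDatum_smul hv.1 l, ?_, fun h => hv.2.2 ?_⟩
  · rw [curl_smul_fun]
    exact hv.2.1.smul_left (f := fun _ : E3 => l)
  · funext x
    have hx := congr_fun h x
    rw [curl_smul_fun] at hx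
    simpa [hl] using hx

/-- the vorticity of a class member is continuous [folklore] -/
theorem continuous_curl_of (hv : IsOuroDatum v) : Continuous (curl v) :=
  continuous_curl (hv.1.1.of_le (by norm_num))

/-- **enstrophy is positive on the class** [folklore] -/
theorem ens_pos (hv : IsOuroDatum v) : 0 < ∫ x, ‖curl v x‖ ^ 2 := by
  obtain ⟨x₀, hx₀⟩ := Function.ne_iff.1 hv.2.2
  have hc : Continuous fun x => ‖curl v x‖ ^ 2 := (continuous_curl_of hv).norm.pow 2
  have hcs : HasCompactSupport fun x => ‖curl v x‖ ^ 2 :=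
    (hv.2.1.norm).comp_left (g := fun r : ℝ => r ^ 2) (by simp)
  have h0 : (fun x => ‖curl v x‖ ^ 2) x₀ ≠ 0 := by simpa using hx₀
  exact hc.integral_pos_of_hasCompactSupport_nonneg_nonzero hcs (fun x => by positivity) h0

/-- **the vorticity sup is positive on the class** (a genuine, attained supremum) [folklore] -/
theorem sup_pos (hv : IsOuroDatum v) : 0 < ⨆ x, ‖curl v x‖ := by
  obtain ⟨x₀, hx₀⟩ := Function.ne_iff.1 hv.2.2
  exact lt_of_lt_of_le (norm_pos_iff.2 hx₀)
    (le_ciSup ((continuous_curl_of hv).norm.bddAbove_range_of_hasCompactSupport hv.2.1.norm) x₀)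

/-- **palinstrophy is positive on the class**: a compactly supported non-zero vorticity on `ℝ³` is not
constant, so its gradient does not vanish identically. [folklore] -/
theorem palin_pos (hv : IsOuroDatum v) : 0 < ∫ x, ‖fderiv ℝ (curl v) x‖ ^ 2 := by
  have h1 : ContDiff ℝ 1 (curl v) := contDiff_curl (n := 1) (hv.1.1.of_le (by exact_mod_cast le_top))
  obtain ⟨x₀, hx₀⟩ := Function.ne_iff.1 hv.2.2
  obtain ⟨x₁, hx₁⟩ : ∃ x, fderiv ℝ (curl v) x ≠ 0 := by
    by_contra h
    push Not at h
    have hc : ∀ x, curl v x = curl v x₀ := fun x =>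
      is_const_of_fderiv_eq_zero (𝕜 := ℝ) (h1.differentiable (by simp)) h x x₀
    have hsupp : Function.support (curl v) = univ :=
      eq_univ_of_forall fun x => by rw [Function.mem_support, hc x]; exact hx₀
    have hts : tsupport (curl v) = univ := by
      apply univ_subset_iff.1
      rw [← hsupp]
      exact subset_tsupport _
    exact noncompact_univ E3 (hts ▸ hv.2.1.isCompact)
  have hc : Continuous fun x => ‖fderiv ℝ (curl v) x‖ ^ 2 := (h1.continuous_fderiv (by simp)).norm.pow 2
  have hcs : HasCompactSupport fun x => ‖fderiv ℝ (curl v) x‖ ^ 2 :=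
    ((hv.2.1.fderiv (𝕜 := ℝ)).norm).comp_left (g := fun r : ℝ => r ^ 2) (by simp)
  have h0 : (fun x => ‖fderiv ℝ (curl v) x‖ ^ 2) x₁ ≠ 0 := by simpa using hx₁
  exact hc.integral_pos_of_hasCompactSupport_nonneg_nonzero hcs (fun x => by positivity) h0

/-! ## E. Local regular solutions from every datum (Majda–Bertozzi Thm. 3.4 — PROVED in the tree) -/

/-- **Local existence in the skeleton's solution class**: for `ν ≥ 0`, every datum of `Chae2007.IsDatum`
launches a regular solution `IsLocalSolution ν T v₀ u p` on some `[0,T)`, `T > 0` — the tree's theorem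
`MajdaBertozzi2002_localExistenceH3_holds` on the closed slab `[0,τ]`, restricted to `[0,τ)`
(`IsClassicalNSSolutionOn.mono`, `HasBoundedSobolevNormsOn.mono`).
[cite: MajdaBertozzi2002, Thm. 3.4 (i)-(ii) p. 104, remark p. 117] -/
theorem exists_isLocalSolution {ν : ℝ} (hν : 0 ≤ ν) {v₀ : E3 → E3} (hv₀ : IsDatum v₀) :
    ∃ T : ℝ, 0 < T ∧ ∃ (u : ℝ → E3 → E3) (p : ℝ → E3 → ℝ), IsLocalSolution ν T v₀ u p := by
  obtain ⟨hsm, hdiv, hH⟩ := hv₀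
  have hfin : (∑ n ∈ Finset.range 4, ∫⁻ x, ‖iteratedFDeriv ℝ n v₀ x‖ₑ ^ 2) ≠ ⊤ :=
    (ENNReal.sum_lt_top.2 fun n _ => hH n).ne
  obtain ⟨τ, hτ, hex⟩ := MajdaBertozzi2002_localExistenceH3_holds hν
    (∑ n ∈ Finset.range 4, ∫⁻ x, ‖iteratedFDeriv ℝ n v₀ x‖ₑ ^ 2).toNNReal
  obtain ⟨v, q, hcl, hv0, hsob⟩ := hex hsm hdiv hH (by rw [ENNReal.coe_toNNReal hfin])
  exact ⟨τ, hτ, v, q,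
    ⟨hcl.mono Ico_subset_Icc_self (uniqueDiffOn_Ico 0 τ), hv0,
      fun T'' hT'' => hsob.mono (Icc_subset_Icc_right hT''.le)⟩⟩

/-! ## K. The kills -/

/-- **The pair mechanism**: for EVERY datum `v` of the class, the slice content of (6) — «some `C₁ > 0` with
`C₁·sup|curl w|·∫|curl w|² ≤ ∫⟪curl w, ∇w (curl w)⟫`» — cannot hold at both `w = v` and `w = −v`: the two
left sides are positive (`sup_pos`, `ens_pos`) and even under `v ↦ −v`, the right side is odd (`stretchI_smul`).
[cite: LucardoOlivaes2026, (6) p.2 l.44–54] -/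
theorem display6_fails_at_pair (hv : IsOuroDatum v) :
    ¬ ((∃ C₁ : ℝ, 0 < C₁ ∧ C₁ * (⨆ x, ‖curl v x‖) * (∫ x, ‖curl v x‖ ^ 2) ≤ stretchI v) ∧
       (∃ C₁ : ℝ, 0 < C₁ ∧ C₁ * (⨆ x, ‖curl (((-1 : ℝ)) • v) x‖) * (∫ x, ‖curl (((-1 : ℝ)) • v) x‖ ^ 2)
          ≤ stretchI (((-1 : ℝ)) • v))) := by
  rintro ⟨⟨C₁, hC₁, h₁⟩, ⟨C₂, hC₂, h₂⟩⟩
  rw [sup_smul, ens_smul, stretchI_smul] at h₂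
  norm_num at h₂
  have hM := sup_pos hv
  have hE := ens_pos hv
  have ha : 0 < C₁ * (⨆ x, ‖curl v x‖) * ∫ x, ‖curl v x‖ ^ 2 := mul_pos (mul_pos hC₁ hM) hE
  have hb : 0 < C₂ * (⨆ x, ‖curl v x‖) * ∫ x, ‖curl v x‖ ^ 2 := mul_pos (mul_pos hC₂ hM) hE
  linarith

/-- **(6) at the SOLUTION grain fails on the pair `{v₀, −v₀}` for every datum `v₀` of the class and every
`ν ≥ 0`**: both launch regular solutions (`exists_isLocalSolution`); at `t = 0` the sentence of `Step6_StretchLower`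
is the slice content of (6) at `v₀`, resp. `−v₀` (`display6_fails_at_pair`). [cite: LucardoOlivaes2026, (6) p.2 l.44–54] -/
theorem stretchLower_fails_at_pair {ν : ℝ} (hν : 0 ≤ ν) (hv : IsOuroDatum v) :
    ¬ ∀ w : E3 → E3, (w = v ∨ w = ((-1 : ℝ)) • v) → ∃ C₁ : ℝ, 0 < C₁ ∧
      ∀ (T : ℝ) (u : ℝ → E3 → E3) (p : ℝ → E3 → ℝ), IsLocalSolution ν T w u p →
        ∀ t ∈ Ico 0 T, C₁ * supVort u t * ensq u t ≤ stretchI (u t) := by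
  intro h
  have key : ∀ w : E3 → E3, (w = v ∨ w = ((-1 : ℝ)) • v) → IsDatum w →
      ∃ C₁ : ℝ, 0 < C₁ ∧ C₁ * (⨆ x, ‖curl w x‖) * (∫ x, ‖curl w x‖ ^ 2) ≤ stretchI w := by
    intro w hw hwd
    obtain ⟨C₁, hC₁, h₁⟩ := h w hw
    obtain ⟨T, hT, u, p, hs⟩ := exists_isLocalSolution hν hwd
    have a := h₁ T u p hs 0 ⟨le_rfl, hT⟩
    simp only [supVort, ensq, hs.initial] at a
    exact ⟨C₁, hC₁, a⟩
  exact display6_fails_at_pair hv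
    ⟨key v (Or.inl rfl) hv.1, key _ (Or.inr rfl) (isOuroDatum_smul hv (by norm_num)).1⟩

/-- **C137 — the typed locator step is false: `¬ Step6_StretchLower`** ((6) §4.1 p. 2 l. 44–54, solution
grain, CARD-predicted locator): instance `ν = 1`, datum pair `{u₀, −u₀}`. First failing step =
`Step6_StretchLower` = (6) p. 2 l. 44–54, class = false lemma (countermodel). [cite: LucardoOlivaes2026, (6) p.2 l.44–54] -/
theorem not_Step6_StretchLower : ¬ Step6_StretchLower :=
  fun h => stretchLower_fails_at_pair zero_le_one isOuroDatum_u0 fun w hw =>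
    h 1 one_pos w (hw.elim (fun e => e ▸ isOuroDatum_u0) fun e => e ▸ isOuroDatum_smul isOuroDatum_u0 (by norm_num))

/-- **(6), per-datum functions face (the referee's charitable reading R#2), is false**: «for every datum of the
class some `C₁ > 0` with `C₁‖∇×v‖_∞‖∇×v‖² ≤ ∫(∇×v)·((∇×v)·∇)v`» fails on the pair `{u₀, −u₀}`.
[cite: LucardoOlivaes2026, (6) p.2 l.44–54] -/
theorem not_step6F_perDatum :
    ¬ ∀ v : E3 → E3, IsOuroDatum v → ∃ C₁ : ℝ, 0 < C₁ ∧
      C₁ * (⨆ x, ‖curl v x‖) * (∫ x, ‖curl v x‖ ^ 2) ≤ stretchI v :=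
  fun h => display6_fails_at_pair isOuroDatum_u0
    ⟨h u0 isOuroDatum_u0, h _ (isOuroDatum_smul isOuroDatum_u0 (by norm_num))⟩

/-- **(6), uniform functions face, is false: `¬ Step6F_StretchLower_fun`** (a uniform `C₁` is a fortiori a
per-datum one). [cite: LucardoOlivaes2026, (6) p.2 l.44–54] -/
theorem not_Step6F_StretchLower_fun : ¬ Step6F_StretchLower_fun :=
  fun ⟨C₁, hC₁, h⟩ => not_step6F_perDatum fun v hv => ⟨C₁, hC₁, h v hv⟩

/-- **§5's rate sentence fails along the amplitude ray of EVERY datum of the class, at every `ν > 0`**: on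
`{A·v₀ : A > 0}` (inside the class, same geometry as `v₀`) `ν∫‖∇(∇×v)‖²` has degree `2` and `(∫‖∇×v‖²)^{2/3}`
degree `4/3` in `A`, and `ν∫‖∇(∇×v₀)‖² > 0` (`palin_pos`): no constant `C₃` serves the ray
(`ScalingAudit.not_exists_forall_le_of_amplitude_exponent_ne`). [cite: LucardoOlivaes2026, §5 p.2 l.56–66] -/
theorem dissipRate_ray_fails {ν : ℝ} (hν : 0 < ν) {v₀ : E3 → E3} (hv₀ : IsOuroDatum v₀) :
    ¬ ∃ C₃ : ℝ, ∀ A : ℝ, 0 < A →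
      ν * ∫ x, ‖fderiv ℝ (curl (A • v₀)) x‖ ^ 2 ≤ C₃ * (∫ x, ‖curl (A • v₀) x‖ ^ 2) ^ (2 / 3 : ℝ) := by
  have key := ScalingAudit.not_exists_forall_le_of_amplitude_exponent_ne
    (S := {v : E3 → E3 | ∃ A : ℝ, 0 < A ∧ v = A • v₀})
    (F := fun v => ν * ∫ x, ‖fderiv ℝ (curl v) x‖ ^ 2) (G := fun v => (∫ x, ‖curl v x‖ ^ 2) ^ (2 / 3 : ℝ))
    (s := 2) (r := 4 / 3) ?_ ?_ ?_ (by norm_num) (u₀ := (1 : ℝ) • v₀) ⟨1, one_pos, rfl⟩ ?_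
  · rintro ⟨C₃, hC⟩
    exact key ⟨C₃, fun v ⟨A, hA, hv⟩ => hv ▸ hC A hA⟩
  · rintro l hl v ⟨A, hA, rfl⟩
    exact ⟨l * A, mul_pos hl hA, smul_smul l A v₀⟩
  · rintro l hl v ⟨A, hA, rfl⟩
    simp only [palin_smul, Real.rpow_two]
    ring
  · rintro l hl v ⟨A, hA, rfl⟩
    simp only [ens_smul]
    rw [Real.mul_rpow (by positivity) (by positivity), ← Real.rpow_natCast l 2, ← Real.rpow_mul hl.le]
    norm_num
  · simp only [one_smul]
    exact mul_pos hν (palin_pos hv₀)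

/-- **§5's rate sentence, functions face over the class, fails at every `ν > 0`** (ray of `u₀`).
[cite: LucardoOlivaes2026, §5 p.2 l.56–66] -/
theorem dissipRate_fun_fails {ν : ℝ} (hν : 0 < ν) :
    ¬ ∃ C₃ : ℝ, 0 ≤ C₃ ∧ ∀ v : E3 → E3, IsOuroDatum v →
      ν * ∫ x, ‖fderiv ℝ (curl v) x‖ ^ 2 ≤ C₃ * (∫ x, ‖curl v x‖ ^ 2) ^ (2 / 3 : ℝ) :=
  fun ⟨C₃, _, h⟩ => dissipRate_ray_fails hν isOuroDatum_u0
    ⟨C₃, fun _ hA => h _ (isOuroDatum_smul isOuroDatum_u0 hA.ne')⟩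

/-- **C137 — §5's rate sentence, functions face, is false: `¬ Step7F_DissipRate_fun`** (instance `ν = 1`).
[cite: LucardoOlivaes2026, §5 p.2 l.56–66] -/
theorem not_Step7F_DissipRate_fun : ¬ Step7F_DissipRate_fun :=
  fun h => dissipRate_fun_fails one_pos (h 1 one_pos)

end Summit.NavierStokesRegularity.NavierStokesRegularity.Theorems.LucardoOlivaes2026

end

-- WHAT THIS IS NOT: not a claim about NS regularity or blow-up; not a claim about any author beyond the
-- typed locator.
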